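import Literature.AlgebraicGeometry.Resolution.DerivativeIdealsLocalization
import Mathlib.RingTheory.Localization.AtPrime.Basic
import Mathlib.RingTheory.Localization.Ideal
import Mathlib.RingTheory.Ideal.Quotient.Operations
import Mathlib.RingTheory.Ideal.IdempotentFG
import Mathlib.RingTheory.Polynomial.Basic
import Mathlib.RingTheory.MvPolynomial.Basic
import Mathlib.Algebra.MvPolynomial.PDeriv
import Mathlib.RingTheory.Derivation.Basic
import Mathlib.RingTheory.Jacobson.Ring
import Mathlib.RingTheory.Algebraic.Integral
import Mathlib.RingTheory.FiniteType
import Mathlib.RingTheory.Spectrum.Prime.Basic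
import HarnessLib

/-!
# The linear form `Σ tⱼ cⱼ` is a regular parameter: pure commutative algebra

Support file for crux stmt-ResolutionOfSingularities-15960
(`SectionAscent.FibrewiseClosedPoints`, line `registered`, calibration stub
`stub_certificatesOnRegularBlowup`: a closed point of a REGULAR blowing up carries a section
certificate). The strict transform of the generic member `Σ tⱼ gⱼ` of a linear system has, on a
chart with chart ring `C`, local rings `T/(ℓ')` where `T` is a localization of
`C[t₁, …, t_s]` at a prime `𝔔` avoiding the non-zero scalars of `K[t]` and
`ℓ' = Σ tⱼ cⱼ` (`cⱼ = gⱼ/bᵐ`). This file proves that `ℓ'` is NOT in `𝔪_T²`: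

* `algebraMap_linearForm_not_mem_sq` — if some `cⱼ ∉ 𝔔` (off the base locus): the partial
  derivative `∂/∂tⱼ` extends to `T`, maps `𝔪_T²` into `𝔪_T`, and `∂ℓ'/∂tⱼ = cⱼ` is a unit;
* `algebraMap_linearForm_not_mem_sq_of_isMaximal` — if the `cⱼ` generate a MAXIMAL ideal `q`
  of `C` contained in `𝔔`, `C` of finite type over the field `K` and some `cⱼ ≠ 0` (at the base
  point): `𝔔 = q C[t]` (`eq_map_C_of_isMaximal`: `C/q` is algebraic over `K` by the
  Nullstellensatz, and a non-zero prime of `(C/q)[t]` contains a non-zero scalar polynomial),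
  and `u ℓ' ∈ q² C[t]` with `u ∉ q C[t]` forces every `cⱼ ∈ q²` (`mem_sq_of_mul_linearForm_mem`,
  a leading-coefficient argument), contradicting `q ≠ q²` (`exists_not_mem_sq`);
* `derivation_apply_mem_of_mem_sq`, `pderiv_sum_C_mul_X`, `primeSpectrum_eq_of_comap_eq`
  (primes of `S⁻¹D/J` are determined by their contraction to `D`) — bookkeeping.

References: H. Matsumura, *Commutative Ring Theory*, Thm. 14.2 (regular parameters), Thm. 5.3
(Nullstellensatz); everything here is folklore. No definitions are introduced.
-/

-- single-problem summit: the doubled namespace component is forced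
set_option linter.dupNamespace false

noncomputable section

namespace Summit.ResolutionOfSingularities.ResolutionOfSingularities.Theorems.SectionAscent.CertificatesOnRegularBlowup

open MvPolynomial IsLocalRing
open scoped BigOperators

/-! ## Primes of a localization followed by a surjection -/

/-- If every element of `E` is `θ(d) θ(s)⁻¹` with `s ∈ S` (`E = S⁻¹D/J`), a prime `𝔮₂` of `E`
whose contraction avoids `S` is the only prime with its contraction to `D`. [folklore] -/
theorem primeSpectrum_eq_of_comap_eq {D E : Type*} [CommRing D] [CommRing E] (θ : D →+* E)
    (S : Submonoid D) (hgen : ∀ e : E, ∃ s ∈ S, ∃ d : D, e * θ s = θ d)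
    {𝔮₁ 𝔮₂ : PrimeSpectrum E} (hS : ∀ s ∈ S, s ∉ 𝔮₂.asIdeal.comap θ)
    (h : 𝔮₁.asIdeal.comap θ = 𝔮₂.asIdeal.comap θ) : 𝔮₁ = 𝔮₂ := by
  ext e
  obtain ⟨s, hs, d, hd⟩ := hgen e
  have hθs : θ s ∉ 𝔮₂.asIdeal := fun h' => hS s hs (Ideal.mem_comap.mpr h')
  have hθs₁ : θ s ∉ 𝔮₁.asIdeal := fun h' => hS s hs (h ▸ Ideal.mem_comap.mpr h')
  constructor
  · intro he
    have h1 : d ∈ 𝔮₂.asIdeal.comap θ := by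
      rw [← h, Ideal.mem_comap, ← hd]
      exact Ideal.mul_mem_right _ _ he
    have h2 : e * θ s ∈ 𝔮₂.asIdeal := by rw [hd]; exact h1
    exact ((𝔮₂.isPrime.mem_or_mem h2).resolve_right hθs)
  · intro he
    have h1 : d ∈ 𝔮₁.asIdeal.comap θ := by
      rw [h, Ideal.mem_comap, ← hd]
      exact Ideal.mul_mem_right _ _ he
    have h2 : e * θ s ∈ 𝔮₁.asIdeal := by rw [hd]; exact h1
    exact ((𝔮₁.isPrime.mem_or_mem h2).resolve_right hθs₁)

/-! ## Derivations and `𝔪²` -/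

/-- A derivation maps `M²` into `M` (Leibniz). [folklore] -/
theorem derivation_apply_mem_of_mem_sq {k T : Type*} [CommRing k] [CommRing T] [Algebra k T]
    (δ : Derivation k T T) (M : Ideal T) {x : T} (hx : x ∈ M ^ 2) : δ x ∈ M := by
  rw [pow_two] at hx
  refine Submodule.mul_induction_on hx (fun a ha b hb => ?_) (fun y z hy hz => ?_)
  · rw [Derivation.leibniz, smul_eq_mul, smul_eq_mul]
    exact M.add_mem (M.mul_mem_right _ ha) (M.mul_mem_right _ hb)
  · rw [map_add]
    exact M.add_mem hy hz

/-- `∂/∂tⱼ (Σᵢ cᵢ tᵢ) = cⱼ`. [folklore] -/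
theorem pderiv_sum_C_mul_X {R : Type*} [CommRing R] {n : ℕ} (c : Fin n → R) (j : Fin n) :
    pderiv j (∑ i : Fin n, C (c i) * X i) = C (c j) := by
  rw [map_sum, Finset.sum_eq_single j]
  · rw [pderiv_C_mul, pderiv_X_self, mul_one]
  · intro i _ hij
    rw [pderiv_C_mul, pderiv_X_of_ne hij, mul_zero]
  · intro h
    exact absurd (Finset.mem_univ j) h

/-- **Off the base locus `ℓ' = Σ tⱼ cⱼ` is a regular parameter**: if `T` is a localization of
`C[t₁, …, t_s]` at a prime `𝔔` with `cⱼ ∉ 𝔔` for some `j`, then `ℓ' ∉ 𝔪_T²` — the partial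
derivative `∂/∂tⱼ` extends to a derivation of `T` mapping `𝔪_T²` into `𝔪_T`, while
`∂ℓ'/∂tⱼ = cⱼ` is a unit of `T`. [folklore] -/
theorem algebraMap_linearForm_not_mem_sq {R : Type} [CommRing R] {s : ℕ} (c : Fin s → R)
    (𝔔 : Ideal (MvPolynomial (Fin s) R)) [𝔔.IsPrime] (T : Type) [CommRing T] [IsLocalRing T]
    [Algebra (MvPolynomial (Fin s) R) T] [IsLocalization.AtPrime T 𝔔] {j : Fin s}
    (hj : C (c j) ∉ 𝔔) :
    algebraMap (MvPolynomial (Fin s) R) T (∑ i : Fin s, C (c i) * X i) ∉ (maximalIdeal T) ^ 2 := by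
  letI : Algebra R T := ((algebraMap (MvPolynomial (Fin s) R) T).comp C).toAlgebra
  haveI : IsScalarTower R (MvPolynomial (Fin s) R) T :=
    IsScalarTower.of_algebraMap_eq fun _ => rfl
  obtain ⟨δ, hδ⟩ := Literature.AlgebraicGeometry.Resolution.exists_derivation_extend_of_isLocalization
    R T 𝔔.primeCompl (pderiv j)
  intro hmem
  have h1 := derivation_apply_mem_of_mem_sq δ _ hmem
  rw [hδ, pderiv_sum_C_mul_X,
    IsLocalization.AtPrime.to_map_mem_maximal_iff T 𝔔] at h1
  exact hj h1

/-! ## At the base point: `𝔔 = q C[t]` and the leading-coefficient argument -/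

/-- **Leading-coefficient lemma.** Let `q` be a maximal ideal of `C`, `cⱼ ∈ q`, and
`u ∈ C[t₁, …, t_s]` a polynomial with some coefficient outside `q` such that
`u · Σ cᵢ tᵢ ∈ q² C[t]`. Then every `cⱼ ∈ q²`: among the exponents `α` with `u_α ∉ q` take one
with `αⱼ` maximal; the coefficient of `t^{α + eⱼ}` in `u ℓ'` is `u_α cⱼ` plus terms
`u_β cᵢ` with `βⱼ = αⱼ + 1`, hence `u_β ∈ q`; so `u_α cⱼ ∈ q²` with `u_α` a unit mod `q`.
[folklore] -/
theorem mem_sq_of_mul_linearForm_mem {R : Type*} [CommRing R] (q : Ideal R) [hq : q.IsMaximal]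
    {s : ℕ} (c : Fin s → R) (hc : ∀ j, c j ∈ q) (u : MvPolynomial (Fin s) R)
    (hu : u ∉ q.map (C : R →+* MvPolynomial (Fin s) R))
    (h : u * (∑ i : Fin s, C (c i) * X i) ∈ (q ^ 2).map (C : R →+* MvPolynomial (Fin s) R))
    (j : Fin s) : c j ∈ q ^ 2 := by
  classical
  rw [MvPolynomial.mem_map_C_iff] at hu h
  push Not at hu
  obtain ⟨α₀, hα₀⟩ := hu
  -- the exponents whose coefficient lies outside `q`
  set U : Finset (Fin s →₀ ℕ) := u.support.filter fun α => u.coeff α ∉ q with hU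
  have hUmem : ∀ β, β ∈ U ↔ u.coeff β ∉ q := by
    intro β
    rw [hU, Finset.mem_filter, mem_support_iff]
    exact ⟨fun h => h.2, fun h => ⟨fun h0 => h (h0 ▸ q.zero_mem), h⟩⟩
  have hUne : U.Nonempty := ⟨α₀, (hUmem α₀).mpr hα₀⟩
  obtain ⟨α, hαU, hαmax⟩ := Finset.exists_max_image U (fun β => β j) hUne
  have hα : u.coeff α ∉ q := (hUmem α).mp hαU
  -- the coefficient formula for `u · Σ cᵢ tᵢ`
  have key : ∀ n : Fin s →₀ ℕ, (u * ∑ i : Fin s, C (c i) * X i).coeff n =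
      ∑ i : Fin s, if i ∈ n.support then u.coeff (n - Finsupp.single i 1) * c i else 0 := by
    intro n
    rw [Finset.mul_sum, coeff_sum]
    refine Finset.sum_congr rfl fun i _ => ?_
    rw [show u * (C (c i) * X i) = C (c i) * (u * X i) by ring, coeff_C_mul, coeff_mul_X']
    split_ifs
    · rw [mul_comm]
    · rw [mul_zero]
  have h1 := h (α + Finsupp.single j 1)
  rw [key, ← Finset.add_sum_erase _ _ (Finset.mem_univ j)] at h1
  have hjsupp : j ∈ (α + Finsupp.single j 1).support := by
    rw [Finsupp.mem_support_iff, Finsupp.add_apply, Finsupp.single_eq_same]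
    omega
  rw [if_pos hjsupp, add_tsub_cancel_right] at h1
  -- the other terms lie in `q²`
  have hrest : (∑ i ∈ Finset.univ.erase j, if i ∈ (α + Finsupp.single j 1).support then
      u.coeff (α + Finsupp.single j 1 - Finsupp.single i 1) * c i else 0) ∈ q ^ 2 := by
    refine Ideal.sum_mem _ fun i hi => ?_
    have hij : i ≠ j := Finset.ne_of_mem_erase hi
    split_ifs with hi'
    · have hβ : u.coeff (α + Finsupp.single j 1 - Finsupp.single i 1) ∈ q := by
        by_contra hβ
        have hle := hαmax _ ((hUmem _).mpr hβ)
        simp only [Finsupp.coe_tsub, Finsupp.coe_add, Pi.sub_apply, Pi.add_apply,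
          Finsupp.single_eq_same, Finsupp.single_eq_of_ne hij.symm] at hle
        omega
      rw [pow_two]
      exact Ideal.mul_mem_mul hβ (hc i)
    · exact Ideal.zero_mem _
  have h2 : u.coeff α * c j ∈ q ^ 2 := by
    have := Ideal.sub_mem _ h1 hrest
    rwa [add_sub_cancel_right] at this
  -- `u_α` is a unit modulo `q`
  obtain ⟨v, i, hi, hvi⟩ := hq.exists_inv hα
  have : c j = v * (u.coeff α * c j) + i * c j := by
    calc c j = (v * u.coeff α + i) * c j := by rw [hvi, one_mul]
      _ = v * (u.coeff α * c j) + i * c j := by ring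
  rw [this]
  refine Ideal.add_mem _ (Ideal.mul_mem_left _ _ h2) ?_
  rw [pow_two]
  exact Ideal.mul_mem_mul hi (hc j)

/-- **At the base point the prime is extended**: let `C` be of finite type over a field `K`,
`q ⊆ C` maximal, `𝔔` a prime of `C[t₁, …, t_s]` containing `q C[t]` and no non-zero scalar
polynomial of `K[t]`. Then `𝔔 = q C[t]`: `C/q` is algebraic over `K` (Nullstellensatz), so a
non-zero element of the prime `𝔔/qC[t]` of `(C/q)[t]` divides a non-zero polynomial of `K[t]`
(`MvPolynomial.exists_dvd_map_of_isAlgebraic`). [folklore] -/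
theorem eq_map_C_of_isMaximal (K R : Type*) [Field K] [CommRing R] [Algebra K R]
    [Algebra.FiniteType K R] (q : Ideal R) [hq : q.IsMaximal] {s : ℕ}
    (𝔔 : Ideal (MvPolynomial (Fin s) R)) [𝔔.IsPrime]
    (hq𝔔 : q.map (C : R →+* MvPolynomial (Fin s) R) ≤ 𝔔)
    (hS : ∀ σ : MvPolynomial (Fin s) K, σ ≠ 0 → MvPolynomial.map (algebraMap K R) σ ∉ 𝔔) :
    𝔔 = q.map (C : R →+* MvPolynomial (Fin s) R) := by
  refine le_antisymm ?_ hq𝔔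
  letI : Field (R ⧸ q) := Ideal.Quotient.field q
  haveI : Algebra.FiniteType K (R ⧸ q) :=
    Algebra.FiniteType.trans (S := R) inferInstance inferInstance
  haveI : Module.Finite K (R ⧸ q) := finite_of_finite_type_of_isJacobsonRing K (R ⧸ q)
  haveI : Algebra.IsIntegral K (R ⧸ q) := Algebra.IsIntegral.of_finite K (R ⧸ q)
  let π : MvPolynomial (Fin s) R →+* MvPolynomial (Fin s) (R ⧸ q) :=
    MvPolynomial.map (Ideal.Quotient.mk q)
  have hπ : Function.Surjective π := MvPolynomial.map_surjective _ Ideal.Quotient.mk_surjective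
  have hkerπ : RingHom.ker π = q.map C := by
    change RingHom.ker (MvPolynomial.map _) = _
    rw [MvPolynomial.ker_map, Ideal.mk_ker]
  haveI : (𝔔.map π).IsPrime := Ideal.map_isPrime_of_surjective hπ (by rw [hkerπ]; exact hq𝔔)
  -- `𝔔/qR[t]` meets `K[t]` trivially, hence vanishes
  have hbot : 𝔔.map π = ⊥ := by
    by_contra hne
    obtain ⟨f, hf, hf0⟩ := Submodule.exists_mem_ne_zero_of_ne_bot hne
    obtain ⟨g, hg0, hdvd⟩ := MvPolynomial.exists_dvd_map_of_isAlgebraic (R := K) hf0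
    have hgmem : MvPolynomial.map (algebraMap K (R ⧸ q)) g ∈ 𝔔.map π :=
      Ideal.mem_of_dvd _ hdvd hf
    have hcomp : MvPolynomial.map (algebraMap K (R ⧸ q)) g =
        π (MvPolynomial.map (algebraMap K R) g) := by
      change _ = MvPolynomial.map _ (MvPolynomial.map _ g)
      rw [MvPolynomial.map_map]
      rfl
    rw [hcomp, ← Ideal.mem_comap, Ideal.comap_map_of_surjective _ hπ,
      sup_eq_left.mpr (by rw [← RingHom.ker_eq_comap_bot, hkerπ]; exact hq𝔔)] at hgmem
    exact hS g hg0 hgmem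
  intro x hx
  have hx' : π x ∈ 𝔔.map π := Ideal.mem_map_of_mem π hx
  rw [hbot, Ideal.mem_bot, ← RingHom.mem_ker, hkerπ] at hx'
  exact hx'

/-- A proper ideal `q = (c₁, …, c_s) ≠ 0` of a Noetherian domain is not idempotent, so some
`cⱼ ∉ q²`. [folklore] -/
theorem exists_not_mem_sq {R : Type*} [CommRing R] [IsDomain R] [IsNoetherianRing R]
    (q : Ideal R) (hq : q ≠ ⊤) {s : ℕ} (c : Fin s → R) (hcq : q = Ideal.span (Set.range c))
    (h0 : ∃ j, c j ≠ 0) : ∃ j, c j ∉ q ^ 2 := by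
  by_contra H
  push Not at H
  have hle : q ≤ q ^ 2 := by
    rw [hcq, Ideal.span_le]
    rintro _ ⟨j, rfl⟩
    exact hcq ▸ H j
  have hidem : IsIdempotentElem q := by
    change q * q = q
    exact le_antisymm Ideal.mul_le_right (by rwa [← pow_two])
  rcases (Ideal.isIdempotentElem_iff_eq_bot_or_top q (IsNoetherian.noetherian q)).mp hidem with
    h | h
  · obtain ⟨j, hj⟩ := h0
    apply hj
    have : c j ∈ q := hcq ▸ Ideal.subset_span ⟨j, rfl⟩
    rwa [h, Ideal.mem_bot] at this
  · exact hq h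

/-- **At the base point `ℓ' = Σ tⱼ cⱼ` is a regular parameter.** `C` a domain of finite type
over a field `K`, `q = (c₁, …, c_s)` a MAXIMAL ideal with some `cⱼ ≠ 0`, `𝔔 ∋ cⱼ` a prime of
`C[t₁, …, t_s]` containing no non-zero scalar polynomial, `T = C[t]_𝔔`. Then `ℓ' ∉ 𝔪_T²`:
`𝔔 = qC[t]` (`eq_map_C_of_isMaximal`), so `ℓ' ∈ 𝔪_T² = q²T` gives `u ℓ' ∈ q²C[t]` with
`u ∉ qC[t]`, whence all `cⱼ ∈ q²` (`mem_sq_of_mul_linearForm_mem`), contradicting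
`exists_not_mem_sq`. [folklore] -/
theorem algebraMap_linearForm_not_mem_sq_of_isMaximal (K R : Type) [Field K] [CommRing R]
    [IsDomain R] [Algebra K R] [Algebra.FiniteType K R] {s : ℕ} (c : Fin s → R) (q : Ideal R)
    [hq : q.IsMaximal] (hcq : q = Ideal.span (Set.range c)) (h0 : ∃ j, c j ≠ 0)
    (𝔔 : Ideal (MvPolynomial (Fin s) R)) [𝔔.IsPrime] (h𝔔 : ∀ j, C (c j) ∈ 𝔔)
    (hS : ∀ σ : MvPolynomial (Fin s) K, σ ≠ 0 → MvPolynomial.map (algebraMap K R) σ ∉ 𝔔)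
    (T : Type) [CommRing T] [IsLocalRing T] [Algebra (MvPolynomial (Fin s) R) T]
    [IsLocalization.AtPrime T 𝔔] :
    algebraMap (MvPolynomial (Fin s) R) T (∑ i : Fin s, C (c i) * X i) ∉ (maximalIdeal T) ^ 2 := by
  haveI : IsNoetherianRing R := Algebra.FiniteType.isNoetherianRing K R
  have hc : ∀ j, c j ∈ q := fun j => hcq ▸ Ideal.subset_span ⟨j, rfl⟩
  have hq𝔔 : q.map (C : R →+* MvPolynomial (Fin s) R) ≤ 𝔔 := by
    rw [hcq, Ideal.map_span, Ideal.span_le]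
    rintro _ ⟨_, ⟨j, rfl⟩, rfl⟩
    exact h𝔔 j
  have h𝔔eq := eq_map_C_of_isMaximal K R q 𝔔 hq𝔔 hS
  obtain ⟨j, hj⟩ := exists_not_mem_sq q hq.ne_top c hcq h0
  intro hmem
  apply hj
  rw [← IsLocalization.AtPrime.map_eq_maximalIdeal 𝔔 T, ← Ideal.map_pow,
    IsLocalization.algebraMap_mem_map_algebraMap_iff 𝔔.primeCompl T] at hmem
  obtain ⟨u, hu, hmul⟩ := hmem
  refine mem_sq_of_mul_linearForm_mem q c hc u ?_ ?_ j
  · rw [← h𝔔eq]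
    exact hu
  · rw [Ideal.map_pow, ← h𝔔eq]
    exact hmul

/-- **Registered form** (`stub_certificatesOnRegularBlowupAlgebra`): at the base point the linear
form `ℓ' = Σ tⱼ cⱼ` is a regular parameter of `T = R[t]_𝔔` — see
`algebraMap_linearForm_not_mem_sq_of_isMaximal`. [cite: Matsumura1987, Thm. 14.2] -/
theorem stub_certificatesOnRegularBlowupAlgebra (K R : Type) [Field K] [CommRing R] [IsDomain R] [Algebra K R] [Algebra.FiniteType K R] (s : ℕ) (c : Fin s → R) (q : Ideal R) [q.IsMaximal] (hcq : q = Ideal.span (Set.range c)) (h0 : ∃ j, c j ≠ 0) (𝔔 : Ideal (MvPolynomial (Fin s) R)) [𝔔.IsPrime] (h𝔔 : ∀ j, MvPolynomial.C (c j) ∈ 𝔔) (hS : ∀ σ : MvPolynomial (Fin s) K, σ ≠ 0 → MvPolynomial.map (algebraMap K R) σ ∉ 𝔔) (T : Type) [CommRing T] [IsLocalRing T] [Algebra (MvPolynomial (Fin s) R) T] [IsLocalization.AtPrime T 𝔔] : algebraMap (MvPolynomial (Fin s) R) T (∑ i : Fin s, MvPolynomial.C (c i) * MvPolynomial.X i)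 ∉ (IsLocalRing.maximalIdeal T) ^ 2 :=
  algebraMap_linearForm_not_mem_sq_of_isMaximal K R c q hcq h0 𝔔 h𝔔 hS T

end Summit.ResolutionOfSingularities.ResolutionOfSingularities.Theorems.SectionAscent.CertificatesOnRegularBlowup

end
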